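import Literature.NumberTheory.EllipticCurves.HalfIntegralWeightThetaMultiplier
import Literature.NumberTheory.EllipticCurves.HalfIntegralWeightGaussSumsTwo
import HarnessLib

/-!
# Gauss's evaluation of the quadratic Gauss sum (with its sign) from the theta multiplier

For the quadratic Gauss sums `G(a; c) = ∑_{r mod c} e(a r²/c)` of the tree
(`ModularForms.quadGaussSum`, file `HalfIntegralWeightGaussSums`) the absolute value and the
square are elementary (`G(1; p)² = χ₄(p) p`, `|G(a; c)|² = 2c` for `4 ∣ c`, in the tree), but the SIGN
— Gauss's theorem `∑_{r mod D} e(r²/D) = √D` for `D ≡ 1 (mod 4)` and `= i√D` for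
`D ≡ 3 (mod 4)` — is not. This file PROVES it, for every odd modulus `D ≥ 1` (not only primes),
from the theta transformation law already in the tree
(`HalfIntegralWeightThetaTransformation`, (★★): `θ(γz) = (2ic/(cz+d))^{-1/2} G(a;c) θ(z)` for
`γ = (a b; c d) ∈ SL₂(ℤ)`, `4 ∣ c`, principal branch), i.e. by the classical route through theta
functions (Dirichlet/Kronecker; the identity `G(1; 4m) = 2(1+i)√m` below is the Landsberg–Schaar
relation at its simplest), in the form needed for the level-`256` transformation law of the
twisted Shintani theta kernels (route towards Waldspurger's relation for Tunnell's theorem, where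
the sign of `G(1; D)` decides between level `256` and the character `(-1)^{c/256}`).

* `quadGaussSum_four_mul_succ_one` — **`G(1; 4m) = 2(1+i)√m` for every `m ≥ 1`.** Proof: with
  `γ_m = (1 0; 4m 1) = γ₁^m` (`gamFour`), (★★) gives `θ(γ_m z) = (8mi/(4mz+1))^{-1/2} G(1;4m) θ(z)`
  (`thetaMul_gamFour_smul`); computing `θ(γ_{m+1} i) = θ(γ₁(γ_m i))` both ways and cancelling
  `θ(i) ≠ 0` (`quadGaussSum_recursion_raw`) leaves an identity between `G(1;4(m+1))`,
  `G(1;4) G(1;4m)` and three principal square roots, which evaluate (`cpow_half_P_succ`,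
  `cpow_half_Q_mul_P`: `(xy)^{1/2} = x^{1/2} y^{1/2}` when `arg x + arg y ∈ (-π, π]`, with
  `γ_m i = i/(4mi+1)`, `(8i/(4γ_m i+1))(8mi/(4mi+1)) = -64m/(4(m+1)i+1)`, `i^{1/2} = (1+i)/√2`,
  `(-1)^{1/2} = i`) to the recursion `√m G(1;4(m+1)) = √(m+1) G(1;4m)`
  (`quadGaussSum_four_mul_succ`); `G(1;4) = 2(1+i)` starts the induction.
* `quadGaussSum_one_of_mod_four_eq_one`, `quadGaussSum_one_of_mod_four_eq_three` — **Gauss's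
  theorem** `G(1; D) = √D` (`D ≡ 1 (mod 4)`), `= i√D` (`D ≡ 3 (mod 4)`), from
  `G(1; 4D) = G(D; 4) G(4; D)` (the tree's multiplicativity `quadGaussSum_mul_of_coprime`),
  `G(4; D) = G(1; D)` and `G(D; 4) = 2(1 + i^D)`.

No named facts are introduced (D-0026); the only definitions are the matrices `gamFour m` and the
abbreviation `Wc j = 4ji + 1`.

## References

* C. F. Gauss, *Summatio quarumdam serierum singularium* (1811) (the sign of the Gauss sum).
* N. Koblitz, *Introduction to Elliptic Curves and Modular Forms*, GTM 97 (2nd ed. 1993), Ch. IV §1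
  (the theta multiplier and quadratic Gauss sums; Problems on `∑ e^{2πi r²/N}`). [KoblitzECMF1993]
* G. Shimura, *On modular forms of half integral weight*, Ann. of Math. 97 (1973), §1.
  [Shimura1973HalfIntegral]
-/
noncomputable section

open Complex Real
open scoped MatrixGroups

namespace Literature.NumberTheory.EllipticCurves.ModularForms

open UpperHalfPlane hiding I

/-! ### Principal square roots of products -/

/-- `(xy)^s = x^s y^s` when `arg x + arg y ∈ (-π, π]` (principal branches). [folklore] -/
theorem mul_cpow_of_arg {x y : ℂ} (hx : x ≠ 0) (hy : y ≠ 0)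
    (h : x.arg + y.arg ∈ Set.Ioc (-π) π) (s : ℂ) : (x * y) ^ s = x ^ s * y ^ s := by
  rw [cpow_def_of_ne_zero (mul_ne_zero hx hy), cpow_def_of_ne_zero hx, cpow_def_of_ne_zero hy,
    Complex.log_mul hx hy h, add_mul, Complex.exp_add]

/-- `arg z ∈ (-π/2, π/2)` when `Re z > 0`. [folklore] -/
theorem abs_arg_lt_of_re_pos {z : ℂ} (hz : 0 < z.re) : |z.arg| < π / 2 :=
  Complex.abs_arg_lt_pi_div_two_iff.mpr (Or.inl hz)

/-- Two numbers of positive real part have `arg` sum in `(-π, π]`. [folklore] -/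
theorem arg_add_arg_mem_of_re_pos {x y : ℂ} (hx : 0 < x.re) (hy : 0 < y.re) :
    x.arg + y.arg ∈ Set.Ioc (-π) π := by
  have h1 := abs_arg_lt_of_re_pos hx
  have h2 := abs_arg_lt_of_re_pos hy
  rw [abs_lt] at h1 h2
  constructor <;> linarith

/-- `I^{1/2} = (1 + i)/√2`. [folklore] -/
theorem I_cpow_half : (I : ℂ) ^ (1 / 2 : ℂ) = (1 + I) / (Real.sqrt 2 : ℂ) := by
  rw [cpow_def_of_ne_zero I_ne_zero, Complex.log_I]
  have : (π / 2 * I) * (1 / 2 : ℂ) = (π / 4 : ℝ) * I := by push_cast; ring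
  rw [this, Complex.exp_mul_I, ← Complex.ofReal_cos, ← Complex.ofReal_sin, Real.cos_pi_div_four,
    Real.sin_pi_div_four]
  have h2 : (Real.sqrt 2 : ℂ) ≠ 0 := by
    exact_mod_cast (Real.sqrt_pos.mpr (by norm_num : (0 : ℝ) < 2)).ne'
  have hsq : (Real.sqrt 2 : ℂ) ^ 2 = 2 := by
    rw [← Complex.ofReal_pow, Real.sq_sqrt zero_le_two]; norm_num
  push_cast
  rw [eq_div_iff h2]
  linear_combination ((1 + I) / 2 : ℂ) * hsq

/-- `(-1)^{1/2} = i`. [folklore] -/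
theorem neg_one_cpow_half : (-1 : ℂ) ^ (1 / 2 : ℂ) = I := by
  rw [cpow_def_of_ne_zero (neg_ne_zero.mpr one_ne_zero), Complex.log_neg_one]
  have : (π * I) * (1 / 2 : ℂ) = (π / 2 : ℂ) * I := by ring
  rw [this, Complex.exp_pi_div_two_mul_I]

/-- `r^{1/2} = √r` for a nonnegative real `r`. [folklore] -/
theorem ofReal_cpow_half {r : ℝ} (hr : 0 ≤ r) : ((r : ℂ)) ^ (1 / 2 : ℂ) = (Real.sqrt r : ℂ) := by
  rw [Real.sqrt_eq_rpow, Complex.ofReal_cpow hr]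
  norm_num

/-! ### The matrices `γ_m = (1 0; 4m 1)` and the theta multiplier along `γ_{m+1} = γ₁ γ_m` -/

/-- `γ_m = (1 0; 4m 1) ∈ SL₂(ℤ)` (`= γ₁^m`, generator of the stabiliser of the cusp `0` in `Γ₀(4)`). [folklore] -/
def gamFour (m : ℕ) : SL(2, ℤ) :=
  ⟨!![1, 0; 4 * m, 1], by rw [Matrix.det_fin_two_of]; ring⟩

/-- `gamFour_00` (auxiliary). [folklore] -/
@[simp] theorem gamFour_00 (m : ℕ) : (gamFour m) 0 0 = 1 := rfl
/-- `gamFour_01` (auxiliary). [folklore] -/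
@[simp] theorem gamFour_01 (m : ℕ) : (gamFour m) 0 1 = 0 := rfl
/-- `gamFour_10` (auxiliary). [folklore] -/
@[simp] theorem gamFour_10 (m : ℕ) : (gamFour m) 1 0 = 4 * m := rfl
/-- `gamFour_11` (auxiliary). [folklore] -/
@[simp] theorem gamFour_11 (m : ℕ) : (gamFour m) 1 1 = 1 := rfl

/-- `γ_{m+1} = γ₁ γ_m`. [folklore] -/
theorem gamFour_succ (m : ℕ) : gamFour (m + 1) = gamFour 1 * gamFour m := by
  ext i j
  simp only [gamFour, Matrix.SpecialLinearGroup.coe_mul, Matrix.SpecialLinearGroup.coe_mk]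
  fin_cases i <;> fin_cases j
  · simp [Matrix.mul_apply, Fin.sum_univ_two]
  · simp [Matrix.mul_apply, Fin.sum_univ_two]
  · simp [Matrix.mul_apply, Fin.sum_univ_two]; ring
  · simp [Matrix.mul_apply, Fin.sum_univ_two]

/-- `neZero_four_mul` (auxiliary). [folklore] -/
instance neZero_four_mul (m : ℕ) [NeZero m] : NeZero (4 * m) := ⟨by have := NeZero.ne m; omega⟩

open Literature.NumberTheory.EllipticCurves.Tunnell1983 (thetaMul thetaMul_one_smul
  thetaMul_eq_shimuraTheta)

/-- **`θ(γ_m z) = (8mi/(4mz+1))^{-1/2} G(1; 4m) θ(z)`** (`m ≥ 1`): the theta transformation law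
(★★) of `HalfIntegralWeightThetaTransformation` for `γ_m`. [folklore] -/
theorem thetaMul_gamFour_smul (m : ℕ) [NeZero m] (z : ℍ) :
    thetaMul 1 (gamFour m • z) =
      1 / (8 * m * I / (4 * m * (z : ℂ) + 1)) ^ (1 / 2 : ℂ) * quadGaussSum (4 * m) 1 0 *
        thetaMul 1 z := by
  have h := thetaMul_one_smul (γ := gamFour m) (c := 4 * m) (by simp) (dvd_mul_right 4 m) z
  rw [h, gamFour_00, gamFour_11]
  congr 3
  · push_cast
    ring
  · simp

/-- `θ(i) ≠ 0`. [folklore] -/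
theorem thetaMul_one_I_ne_zero : thetaMul 1 UpperHalfPlane.I ≠ 0 := by
  rw [thetaMul_eq_shimuraTheta one_pos]
  have : (UpperHalfPlane.mk ((1 : ℕ) * (UpperHalfPlane.I : ℂ))
      (Literature.NumberTheory.EllipticCurves.Tunnell1983.mul_im_pos one_pos _) : ℍ) =
      UpperHalfPlane.I := by
    apply UpperHalfPlane.ext; push_cast; ring
  rw [this]
  exact shimuraTheta_I_ne_zero

/-- `γ_m · i = i / (4mi + 1)`. [folklore] -/
theorem coe_gamFour_smul_I (m : ℕ) :
    ((gamFour m • UpperHalfPlane.I : ℍ) : ℂ) = I / (4 * m * I + 1) := by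
  rw [coe_smul_eq' (gamFour m) UpperHalfPlane.I, gamFour_00, gamFour_01, gamFour_10, gamFour_11]
  push_cast
  simp

/-- `Re (k i / u) > 0` for `k > 0` and `Im u > 0`. [folklore] -/
theorem re_mul_I_div_pos {k : ℝ} (hk : 0 < k) {u : ℂ} (hu : 0 < u.im) : 0 < ((k : ℂ) * I / u).re := by
  have hu0 : u ≠ 0 := by rintro rfl; simp at hu
  have hn : 0 < Complex.normSq u := Complex.normSq_pos.mpr hu0
  rw [Complex.div_re]
  simp only [Complex.mul_re, Complex.mul_im, Complex.ofReal_re, Complex.ofReal_im, Complex.I_re,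
    Complex.I_im, mul_zero, zero_mul, sub_zero, mul_one, add_zero]
  rw [zero_div, zero_add]
  positivity

/-- **The recursion** in raw form: comparing `θ(γ_{m+1} i)` with `θ(γ₁(γ_m i))` and cancelling
`θ(i) ≠ 0` gives `P_{m+1}⁻¹ G(1;4(m+1)) = Q⁻¹ G(1;4) · P_m⁻¹ G(1;4m)` with the principal square
roots `P_j = (8ji/(4ji+1))^{1/2}`, `Q = (8i/(4 γ_m i + 1))^{1/2}`. [folklore] -/
theorem quadGaussSum_recursion_raw (m : ℕ) [NeZero m] :
    (1 / (8 * (m + 1 : ℕ) * I / (4 * (m + 1 : ℕ) * (UpperHalfPlane.I : ℂ) + 1)) ^ (1 / 2 : ℂ)) *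
        quadGaussSum (4 * (m + 1)) 1 0 =
      (1 / (8 * (1 : ℕ) * I / (4 * (1 : ℕ) * ((gamFour m • UpperHalfPlane.I : ℍ) : ℂ) + 1)) ^
          (1 / 2 : ℂ)) * quadGaussSum (4 * 1) 1 0 *
        ((1 / (8 * m * I / (4 * m * (UpperHalfPlane.I : ℂ) + 1)) ^ (1 / 2 : ℂ)) *
          quadGaussSum (4 * m) 1 0) := by
  have h1 := thetaMul_gamFour_smul (m + 1) UpperHalfPlane.I
  rw [gamFour_succ, mul_smul, thetaMul_gamFour_smul 1, thetaMul_gamFour_smul m] at h1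
  have hθ := thetaMul_one_I_ne_zero
  have h2 : (1 / (8 * (1 : ℕ) * I / (4 * (1 : ℕ) * ((gamFour m • UpperHalfPlane.I : ℍ) : ℂ) + 1)) ^
          (1 / 2 : ℂ)) * quadGaussSum (4 * 1) 1 0 *
        ((1 / (8 * m * I / (4 * m * (UpperHalfPlane.I : ℂ) + 1)) ^ (1 / 2 : ℂ)) *
          quadGaussSum (4 * m) 1 0) * thetaMul 1 UpperHalfPlane.I =
      (1 / (8 * (m + 1 : ℕ) * I / (4 * (m + 1 : ℕ) * (UpperHalfPlane.I : ℂ) + 1)) ^ (1 / 2 : ℂ)) *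
        quadGaussSum (4 * (m + 1)) 1 0 * thetaMul 1 UpperHalfPlane.I := by
    linear_combination h1
  exact (mul_right_cancel₀ hθ h2).symm

/-! ### The branch evaluation -/

/-- `W_j = 4ji + 1`. [folklore] -/
def Wc (j : ℕ) : ℂ := 4 * j * I + 1

/-- `Wc_re` (auxiliary). [folklore] -/
theorem Wc_re (j : ℕ) : (Wc j).re = 1 := by simp [Wc]

/-- `Wc_im` (auxiliary). [folklore] -/
theorem Wc_im (j : ℕ) : (Wc j).im = 4 * j := by simp [Wc]

/-- `Wc_ne_zero` (auxiliary). [folklore] -/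
theorem Wc_ne_zero (j : ℕ) : Wc j ≠ 0 := fun h ↦ by simpa [Wc_re] using congrArg Complex.re h

/-- `Wc_succ` (auxiliary). [folklore] -/
theorem Wc_succ (m : ℕ) : Wc (m + 1) = Wc m + 4 * I := by simp only [Wc]; push_cast; ring

/-- `arg W_j ∈ [0, π/2)` and `> 0` for `j ≥ 1`; hence `arg W_j⁻¹ = -arg W_j ∈ (-π/2, 0]`. [folklore] -/
theorem arg_Wc_mem (j : ℕ) : 0 ≤ (Wc j).arg ∧ (Wc j).arg < π / 2 := by
  constructor
  · rw [Complex.arg_nonneg_iff, Wc_im]; positivity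
  · have := abs_arg_lt_of_re_pos (z := Wc j) (by rw [Wc_re]; norm_num)
    exact (abs_lt.mp this).2

/-- `arg_inv_Wc` (auxiliary). [folklore] -/
theorem arg_inv_Wc (j : ℕ) : (Wc j)⁻¹.arg = -(Wc j).arg := by
  rw [Complex.arg_inv]
  have := (arg_Wc_mem j).2
  have hπ : 0 < π := Real.pi_pos
  rw [if_neg (by linarith)]

/-- `V^{1/2} ≠ 0` for `V = W⁻¹`. [folklore] -/
theorem inv_Wc_cpow_ne_zero (j : ℕ) : ((Wc j)⁻¹) ^ (1 / 2 : ℂ) ≠ 0 := by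
  rw [Ne, Complex.cpow_eq_zero_iff, not_and_or]
  exact Or.inl (inv_ne_zero (Wc_ne_zero j))

/-- `(8(m+1) i · V)^{1/2} = √(8(m+1)) · i^{1/2} · V^{1/2}` for `V = W_{m+1}⁻¹`. [folklore] -/
theorem cpow_half_P_succ (m : ℕ) :
    (8 * ((m + 1 : ℕ) : ℂ) * I * (Wc (m + 1))⁻¹) ^ (1 / 2 : ℂ) =
      (Real.sqrt (8 * (m + 1 : ℕ)) : ℂ) * ((1 + I) / (Real.sqrt 2 : ℂ)) *
        ((Wc (m + 1))⁻¹) ^ (1 / 2 : ℂ) := by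
  have h8 : (0 : ℝ) < 8 * (m + 1 : ℕ) := by positivity
  have hx : (8 * ((m + 1 : ℕ) : ℂ) * I) = ((8 * (m + 1 : ℕ) : ℝ) : ℂ) * I := by push_cast; ring
  have hargx : (8 * ((m + 1 : ℕ) : ℂ) * I).arg = π / 2 := by
    rw [hx, Complex.arg_real_mul _ h8, Complex.arg_I]
  have hx0 : 8 * ((m + 1 : ℕ) : ℂ) * I ≠ 0 := by
    rw [hx]; exact mul_ne_zero (by exact_mod_cast h8.ne') I_ne_zero
  have hV := arg_inv_Wc (m + 1)
  have hW := arg_Wc_mem (m + 1)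
  rw [mul_cpow_of_arg hx0 (inv_ne_zero (Wc_ne_zero _)) (by
    rw [hargx, hV]; constructor <;> linarith [Real.pi_pos])]
  congr 1
  rw [hx, mul_cpow_of_arg (by exact_mod_cast h8.ne') I_ne_zero (by
    rw [Complex.arg_ofReal_of_nonneg h8.le, Complex.arg_I]; constructor <;> linarith [Real.pi_pos]),
    ofReal_cpow_half h8.le, I_cpow_half]

/-- `Q · P_m = 8√m · i · V^{1/2}`: the product of the two square roots attached to `γ₁` at `γ_m i`
and to `γ_m` at `i` (`(8i/(4γ_m i+1)) (8mi/(4mi+1)) = -64m/W_{m+1}`). [folklore] -/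
theorem cpow_half_Q_mul_P (m : ℕ) [NeZero m] :
    (8 * ((1 : ℕ) : ℂ) * I / (4 * ((1 : ℕ) : ℂ) * ((gamFour m • UpperHalfPlane.I : ℍ) : ℂ) + 1)) ^
          (1 / 2 : ℂ) *
        (8 * (m : ℂ) * I / (4 * (m : ℂ) * (UpperHalfPlane.I : ℂ) + 1)) ^ (1 / 2 : ℂ) =
      8 * (Real.sqrt m : ℂ) * I * ((Wc (m + 1))⁻¹) ^ (1 / 2 : ℂ) := by
  have hm : (0 : ℝ) < m := by exact_mod_cast Nat.pos_of_ne_zero (NeZero.ne m)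
  have hI : ((UpperHalfPlane.I : ℍ) : ℂ) = I := rfl
  have hzm := coe_gamFour_smul_I m
  -- real parts of the two bases are positive
  have hre1 : 0 < (8 * ((1 : ℕ) : ℂ) * I /
      (4 * ((1 : ℕ) : ℂ) * ((gamFour m • UpperHalfPlane.I : ℍ) : ℂ) + 1)).re := by
    have := re_mul_I_div_pos (k := 8) (by norm_num)
      (u := 4 * ((1 : ℕ) : ℂ) * ((gamFour m • UpperHalfPlane.I : ℍ) : ℂ) + 1) (by
        simp only [Nat.cast_one, mul_one, Complex.add_im, Complex.mul_im, Complex.one_im,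
          Complex.re_ofNat, Complex.im_ofNat, zero_mul, add_zero, UpperHalfPlane.coe_im]
        linarith [(gamFour m • UpperHalfPlane.I).im_pos])
    simpa using this
  have hre2 : 0 < (8 * (m : ℂ) * I / (4 * (m : ℂ) * (UpperHalfPlane.I : ℂ) + 1)).re := by
    have := re_mul_I_div_pos (k := 8 * m) (by positivity)
      (u := 4 * (m : ℂ) * (UpperHalfPlane.I : ℂ) + 1) (by
        rw [hI]; simp; have := NeZero.ne m; omega)
    push_cast at this
    exact this
  have hne1 : 8 * ((1 : ℕ) : ℂ) * I /
      (4 * ((1 : ℕ) : ℂ) * ((gamFour m • UpperHalfPlane.I : ℍ) : ℂ) + 1) ≠ 0 := by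
    intro h; rw [h] at hre1; simp at hre1
  have hne2 : 8 * (m : ℂ) * I / (4 * (m : ℂ) * (UpperHalfPlane.I : ℂ) + 1) ≠ 0 := by
    intro h; rw [h] at hre2; simp at hre2
  rw [← mul_cpow_of_arg hne1 hne2 (arg_add_arg_mem_of_re_pos hre1 hre2)]
  -- the product of the bases is `-64m · V`
  have hprod : 8 * ((1 : ℕ) : ℂ) * I /
      (4 * ((1 : ℕ) : ℂ) * ((gamFour m • UpperHalfPlane.I : ℍ) : ℂ) + 1) *
        (8 * (m : ℂ) * I / (4 * (m : ℂ) * (UpperHalfPlane.I : ℂ) + 1)) =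
      ((64 * m : ℝ) : ℂ) * (-1) * (Wc (m + 1))⁻¹ := by
    rw [hzm, hI]
    have hW : Wc m ≠ 0 := Wc_ne_zero m
    have hW' : Wc (m + 1) ≠ 0 := Wc_ne_zero (m + 1)
    have e1 : (4 : ℂ) * m * I + 1 = Wc m := rfl
    rw [e1, Wc_succ]
    rw [Wc_succ] at hW'
    have hW4 : Wc m + 4 * I ≠ 0 := hW'
    field_simp
    push_cast
    ring_nf
    rw [Complex.I_sq]
    ring
  rw [hprod]
  have h64 : (0 : ℝ) ≤ 64 * m := by positivity
  have harg1 : (((64 * m : ℝ) : ℂ) * (-1)).arg = π := by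
    rw [Complex.arg_eq_pi_iff]
    constructor
    · simp; have := NeZero.ne m; omega
    · simp
  have hV := arg_inv_Wc (m + 1)
  have hW := arg_Wc_mem (m + 1)
  have hWpos : 0 < (Wc (m + 1)).arg := by
    rcases hW.1.lt_or_eq with h | h
    · exact h
    · exfalso
      have h0 := (Complex.arg_eq_zero_iff.mp h.symm).2
      rw [Wc_im] at h0
      have h1 : (0 : ℝ) < 4 * (m + 1 : ℕ) := by positivity
      linarith
  rw [mul_cpow_of_arg (mul_ne_zero (by exact_mod_cast (by positivity : (64 * m : ℝ) ≠ 0))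
      (neg_ne_zero.mpr one_ne_zero)) (inv_ne_zero (Wc_ne_zero _)) (by
    rw [harg1, hV]; constructor <;> linarith [Real.pi_pos]),
    mul_cpow_of_arg (by exact_mod_cast (by positivity : (64 * m : ℝ) ≠ 0))
      (neg_ne_zero.mpr one_ne_zero) (by
    rw [Complex.arg_ofReal_of_nonneg h64, Complex.arg_neg_one]
    constructor <;> linarith [Real.pi_pos]),
    ofReal_cpow_half h64, neg_one_cpow_half]
  have : Real.sqrt (64 * m) = 8 * Real.sqrt m := by
    rw [Real.sqrt_mul (by norm_num), show (64 : ℝ) = 8 ^ 2 by norm_num, Real.sqrt_sq (by norm_num)]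
  rw [this]
  push_cast
  ring

/-! ### The recursion and Gauss's evaluation -/

/-- `G(1; 4) = 2(1 + i)`. [folklore] -/
theorem quadGaussSum_four_one : quadGaussSum 4 1 0 = 2 * (1 + I) := by
  rw [quadGaussSum_four_eq, stdAddChar_four_one]; ring

/-- **The recursion `√m · G(1; 4(m+1)) = √(m+1) · G(1; 4m)`** (`m ≥ 1`). [folklore] -/
theorem quadGaussSum_four_mul_succ (m : ℕ) [NeZero m] :
    (Real.sqrt m : ℂ) * quadGaussSum (4 * (m + 1)) 1 0 =
      (Real.sqrt ((m : ℝ) + 1) : ℂ) * quadGaussSum (4 * m) 1 0 := by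
  have raw := quadGaussSum_recursion_raw m
  have hP := cpow_half_P_succ m
  have hQP := cpow_half_Q_mul_P m
  set S : ℂ := ((Wc (m + 1))⁻¹) ^ (1 / 2 : ℂ) with hS
  have hS0 : S ≠ 0 := inv_Wc_cpow_ne_zero (m + 1)
  have hI : ((UpperHalfPlane.I : ℍ) : ℂ) = I := rfl
  -- rewrite the base of `P_{m+1}` in the form of `cpow_half_P_succ`
  have eP : (8 * ((m + 1 : ℕ) : ℂ) * I / (4 * ((m + 1 : ℕ) : ℂ) * (UpperHalfPlane.I : ℂ) + 1)) =
      8 * ((m + 1 : ℕ) : ℂ) * I * (Wc (m + 1))⁻¹ := by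
    rw [div_eq_mul_inv]; rfl
  rw [eP, hP] at raw
  have G4 : quadGaussSum (4 * 1) 1 0 = 2 * (1 + I) := quadGaussSum_four_one
  rw [G4] at raw
  -- abbreviations
  set A : ℂ := (8 * ((1 : ℕ) : ℂ) * I /
    (4 * ((1 : ℕ) : ℂ) * ((gamFour m • UpperHalfPlane.I : ℍ) : ℂ) + 1)) ^ (1 / 2 : ℂ) with hA
  set B : ℂ := (8 * (m : ℂ) * I / (4 * (m : ℂ) * (UpperHalfPlane.I : ℂ) + 1)) ^ (1 / 2 : ℂ) with hB
  -- `raw : 1/(√(8(m+1)) e S) G' = 1/A · 2(1+i) · (1/B · Gm)` and `hQP : A B = 8√m i S`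
  have hA0 : A ≠ 0 := by
    intro h; rw [h, zero_mul] at hQP
    have : (8 : ℂ) * (Real.sqrt m : ℂ) * I * S ≠ 0 := by
      refine mul_ne_zero (mul_ne_zero (mul_ne_zero (by norm_num) ?_) I_ne_zero) hS0
      have : (0 : ℝ) < Real.sqrt m :=
        Real.sqrt_pos.mpr (by exact_mod_cast Nat.pos_of_ne_zero (NeZero.ne m))
      exact_mod_cast this.ne'
    exact this hQP.symm
  have hB0 : B ≠ 0 := by
    intro h; rw [h, mul_zero] at hQP
    have : (8 : ℂ) * (Real.sqrt m : ℂ) * I * S ≠ 0 := by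
      refine mul_ne_zero (mul_ne_zero (mul_ne_zero (by norm_num) ?_) I_ne_zero) hS0
      have : (0 : ℝ) < Real.sqrt m :=
        Real.sqrt_pos.mpr (by exact_mod_cast Nat.pos_of_ne_zero (NeZero.ne m))
      exact_mod_cast this.ne'
    exact this hQP.symm
  have h2 : (Real.sqrt 2 : ℂ) ≠ 0 := by
    exact_mod_cast (Real.sqrt_pos.mpr (by norm_num : (0 : ℝ) < 2)).ne'
  have h8 : (Real.sqrt (8 * (m + 1 : ℕ)) : ℂ) ≠ 0 := by
    exact_mod_cast (Real.sqrt_pos.mpr (by positivity : (0 : ℝ) < 8 * (m + 1 : ℕ))).ne'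
  have e1I : (1 + I : ℂ) ≠ 0 := by
    intro h; have := congrArg Complex.re h; simp at this
  -- clear denominators in `raw`
  have key : quadGaussSum (4 * (m + 1)) 1 0 * (A * B) * Real.sqrt 2 =
      Real.sqrt (8 * (m + 1 : ℕ)) * (1 + I) * S * (2 * (1 + I)) * quadGaussSum (4 * m) 1 0 := by
    field_simp at raw
    linear_combination raw
  rw [hQP] at key
  -- `√(8(m+1)) = 2 √2 √(m+1)`, `√2 √2 = 2`, `i² = -1`
  have hsq8 : Real.sqrt (8 * (m + 1 : ℕ)) = 2 * Real.sqrt 2 * Real.sqrt (m + 1 : ℕ) := by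
    rw [Real.sqrt_mul (by norm_num), sqrt_eight]
  have hsq2 : (Real.sqrt 2 : ℂ) * Real.sqrt 2 = 2 := by
    rw [← Complex.ofReal_mul, Real.mul_self_sqrt zero_le_two]; norm_num
  rw [hsq8] at key
  push_cast at key
  -- cancel the common nonzero factor `8 i S √2` (note `(1+i)² = 2i`)
  have hI2 : I * I = -1 := Complex.I_mul_I
  have hmain : (Real.sqrt m : ℂ) * quadGaussSum (4 * (m + 1)) 1 0 * (8 * I * S * Real.sqrt 2) =
      (Real.sqrt ((m : ℝ) + 1) : ℂ) * quadGaussSum (4 * m) 1 0 * (8 * I * S * Real.sqrt 2) := by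
    linear_combination key +
      (4 * S * (Real.sqrt 2 : ℂ) * (Real.sqrt ((m : ℝ) + 1) : ℂ) * quadGaussSum (4 * m) 1 0) * hI2
  have hne : (8 : ℂ) * I * S * Real.sqrt 2 ≠ 0 :=
    mul_ne_zero (mul_ne_zero (mul_ne_zero (by norm_num) I_ne_zero) hS0) h2
  exact mul_right_cancel₀ hne hmain

/-- **The quadratic Gauss sum modulo `4m` with its sign**: `∑_{r mod 4m} e(r²/(4m)) = 2(1+i)√m`
for every `m ≥ 1` (Gauss 1805; here from the theta transformation law by the recursion
`√m G(1;4(m+1)) = √(m+1) G(1;4m)` — a Landsberg–Schaar evaluation without primes).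
[cite: KoblitzECMF1993, Ch. IV §1 (quadratic Gauss sums in the theta multiplier)] -/
theorem quadGaussSum_four_mul_succ_one (n : ℕ) :
    quadGaussSum (4 * (n + 1)) 1 0 = 2 * (1 + I) * (Real.sqrt ((n : ℝ) + 1) : ℂ) := by
  induction n with
  | zero =>
    have : quadGaussSum (4 * (0 + 1)) 1 0 = quadGaussSum 4 1 0 := rfl
    rw [this, quadGaussSum_four_one]
    push_cast
    rw [zero_add, Real.sqrt_one]
    push_cast
    ring
  | succ n ih =>
    have h := quadGaussSum_four_mul_succ (n + 1)
    rw [ih] at h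
    have hs : (Real.sqrt ((n + 1 : ℕ) : ℝ) : ℂ) ≠ 0 := by
      exact_mod_cast (Real.sqrt_pos.mpr (by positivity : (0 : ℝ) < (n + 1 : ℕ))).ne'
    push_cast at h hs ⊢
    have : (Real.sqrt ((n : ℝ) + 1) : ℂ) * quadGaussSum (4 * (n + 1 + 1)) 1 0 =
        (Real.sqrt ((n : ℝ) + 1) : ℂ) * (2 * (1 + I) * Real.sqrt ((n : ℝ) + 1 + 1)) := by
      linear_combination h
    exact mul_left_cancel₀ hs this

/-- `G(4; D) = G(1; D)` for odd `D` (`4 = 2²` is a unit square). [folklore] -/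
theorem quadGaussSum_four_left {D : ℕ} [NeZero D] (hD : Odd D) :
    quadGaussSum D 4 0 = quadGaussSum D 1 0 := by
  have h2 : IsUnit ((2 : ℕ) : ZMod D) := by
    rw [ZMod.isUnit_iff_coprime]
    exact (Nat.coprime_two_left.mpr hD)
  have : (4 : ZMod D) = ((2 : ℕ) : ZMod D) ^ 2 * 1 := by push_cast; norm_num
  rw [this, quadGaussSum_unit_sq_mul h2]

/-- `e(3/4) = -i`. [folklore] -/
theorem stdAddChar_four_three : (ZMod.stdAddChar (3 : ZMod 4) : ℂ) = -I := by
  have : (3 : ZMod 4) = 1 + 2 := by decide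
  rw [this, AddChar.map_add_eq_mul, stdAddChar_four_one, stdAddChar_four_two]; ring

/-- **Gauss's theorem on the sign of the quadratic Gauss sum, `D ≡ 1 (mod 4)`**:
`∑_{r mod D} e(r²/D) = +√D`. [cite: KoblitzECMF1993, Ch. IV §1] -/
theorem quadGaussSum_one_of_mod_four_eq_one {D : ℕ} [NeZero D] (hD : D % 4 = 1) :
    quadGaussSum D 1 0 = (Real.sqrt D : ℂ) := by
  have hodd : Odd D := Nat.odd_iff.mpr (by omega)
  have hcop : Nat.Coprime 4 D := by
    have : Nat.Coprime 2 D := Nat.coprime_two_left.mpr hodd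
    exact Nat.Coprime.pow_left 2 this
  haveI : NeZero (4 * D) := neZero_four_mul D
  have hmul := quadGaussSum_mul_of_coprime hcop 1
  obtain ⟨k, hk⟩ : ∃ k, D = k + 1 := ⟨D - 1, by have := NeZero.ne D; omega⟩
  have h4D : quadGaussSum (4 * D) 1 0 = 2 * (1 + I) * (Real.sqrt D : ℂ) := by
    have h4 := quadGaussSum_four_mul_succ_one k
    subst hk
    push_cast at h4 ⊢
    exact h4
  push_cast at hmul
  simp only [mul_one] at hmul
  rw [h4D, quadGaussSum_four_left hodd] at hmul
  have hD4 : ((D : ℕ) : ZMod 4) = 1 := by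
    rw [← ZMod.natCast_mod D 4, hD]; rfl
  rw [hD4, quadGaussSum_four_one] at hmul
  have h1I : (2 : ℂ) * (1 + I) ≠ 0 := by
    intro h; have := congrArg Complex.re h; simp at this
  exact (mul_left_cancel₀ h1I hmul.symm)

/-- **Gauss's theorem on the sign of the quadratic Gauss sum, `D ≡ 3 (mod 4)`**:
`∑_{r mod D} e(r²/D) = +i√D`. [cite: KoblitzECMF1993, Ch. IV §1] -/
theorem quadGaussSum_one_of_mod_four_eq_three {D : ℕ} [NeZero D] (hD : D % 4 = 3) :
    quadGaussSum D 1 0 = I * (Real.sqrt D : ℂ) := by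
  have hodd : Odd D := Nat.odd_iff.mpr (by omega)
  have hcop : Nat.Coprime 4 D := by
    have : Nat.Coprime 2 D := Nat.coprime_two_left.mpr hodd
    exact Nat.Coprime.pow_left 2 this
  haveI : NeZero (4 * D) := neZero_four_mul D
  have hmul := quadGaussSum_mul_of_coprime hcop 1
  obtain ⟨k, hk⟩ : ∃ k, D = k + 1 := ⟨D - 1, by have := NeZero.ne D; omega⟩
  have h4D : quadGaussSum (4 * D) 1 0 = 2 * (1 + I) * (Real.sqrt D : ℂ) := by
    have h4 := quadGaussSum_four_mul_succ_one k
    subst hk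
    push_cast at h4 ⊢
    exact h4
  push_cast at hmul
  simp only [mul_one] at hmul
  rw [h4D, quadGaussSum_four_left hodd] at hmul
  have hD4 : ((D : ℕ) : ZMod 4) = 3 := by
    rw [← ZMod.natCast_mod D 4, hD]; rfl
  rw [hD4, quadGaussSum_four_eq, stdAddChar_four_three] at hmul
  have h1I : (2 : ℂ) + 2 * -I ≠ 0 := by
    intro h; have := congrArg Complex.re h; simp at this
  have key := mul_left_cancel₀ h1I (hmul.symm.trans
    (by linear_combination (2 * (Real.sqrt D : ℂ)) * Complex.I_mul_I :
    2 * (1 + I) * (Real.sqrt D : ℂ) = (2 + 2 * -I) * (I * Real.sqrt D)))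
  exact key

end Literature.NumberTheory.EllipticCurves.ModularForms
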